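import Literature.Analysis.FluidPDE.DissipationWavenumber
import Literature.Analysis.FluidPDE.SelfSimilar
import HarnessLib

/-!
# Fluid computer — the dyadic ladder of a discretely self-similar field
(rung R3, dictionary behind idea-1's card P-G10-1 `RGFixedPoint`; pub-fluidc-lit gen 38)

HONEST FRAMING (cell `pub-fluidc`, verbatim): *low prior, high value-of-information experiment on Tao's
machine paradigm; NOT a claim that NS blows up.* Theorem side of the cell; nothing here is evidence of
blow-up, and nothing about Navier–Stokes dynamics is asserted: the statements are identities of the
Littlewood–Paley blocks under the dyadic dilation `x ↦ 2x` and their consequences for ANY field that is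
discretely self-similar with factor `2`.

Dictionary.  Card P-G10-1 (idea-1 gen 10; tree file `FluidComputer/RGFixedPoint.lean`) calls a MACHINE a
relative fixed point `M v = σ v` of the renormalised level map — a seed whose ladder has the SAME one-level
gain `g = λ` at every level (`RGFixedPoint.LevelMap.gain_iterate_of_relFixed`).  The literature seat's
placement of the card (cell file `LITERATURE.md` §A22.20) reads that object, continued to all levels, as a
backward `λ`-discretely-self-similar (`λ`-DSS) blow-up — the object of the tree's OPEN wall
`Literature.Analysis.FluidPDE.TypeIDSSLiouville 2` and of the barrier
`Literature/Barriers/NavierStokesRegularity/NearOneDssTypeIExclusion.lean` (which excludes it only for `λ`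
near `1`).  This file types that dictionary in the cell's own currency — the block sup amplitudes
`‖Δ̇_j ·‖_∞` (tree: `Literature.Analysis.FunctionSpaces.blockFn`) and the Cheskidov–Shvydkoy dissipation
wavenumber `Λ_{c₀,ν}` (tree: `Literature.Analysis.FluidPDE.dissipationWavenumber`):

* §1 `blockKernel_succ`, `blockFn_succ_comp_two_smul` — the homogeneous blocks are COVARIANT under the
  dyadic dilation: `Δ̇_{j+1}(v(2·)) = (Δ̇_j v)(2·)` (the kernel identity `K_{j+1}(t) = 2^d K_j(2t)` from the
  tree's `blockKernel_eq_scale` and the change of variables `s = 2t`); with an amplitude,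
  `Δ̇_{j+1}(c · v(2·)) = c · (Δ̇_j v)(2·)`, and over `n` levels, `Δ̇_{j+n}(v(2ⁿ·)) = (Δ̇_j v)(2ⁿ·)`; hence
  `‖Δ̇_{j+1}(c · v(2·))‖_∞ = |c| ‖Δ̇_j v‖_∞` (`eLpNorm_top_blockFn_succ_dilate`).
* §2 for a field `u : ℝ → E → E'` that is `2`-DSS in the tree's sense
  (`Literature.Analysis.FluidPDE.IsDiscretelySelfSimilar 2 u`, i.e. `2 • u (4t) (2x) = u t x`):
  `‖Δ̇_{j+1} u(t)‖_∞ = 2 ‖Δ̇_j u(4t)‖_∞` (`eLpNorm_top_blockFn_succ_of_dss`) — every level reproduces the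
  previous one, one period later (`4t < t < 0` before a singular time `0`), with gain EXACTLY `λ = 2`: the
  rung's floor `r = g/λ ≥ 1` is met with equality at every level, so the floor is sharp on DSS objects;
  saturation moves up one level per period (`isSaturatedLevel_succ_iff_of_dss`) and the dissipation
  wavenumber doubles, `Λ(u t) = 2 Λ(u(4t))` as soon as some level of `u(4t)` is saturated
  (`dissipationWavenumber_eq_two_mul_of_dss`; unconditionally `Λ(u(4t)) ≤ Λ(u t) ≤ 2Λ(u(4t))`).

All proved, 0 sorry, no new definitions or named facts (D-0026).  References for the dilation identity:
H. Bahouri, J.-Y. Chemin, R. Danchin, *Fourier Analysis and Nonlinear PDE* (2011), §2.2 (homogeneous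
blocks `Δ̇_j = φ(2^{-j}D)`, kernel `2^{jd}h(2^j·)`); for `λ`-DSS fields: D. Chae, J. Wolf, Comm. PDE 42
(2017) 1359–1374, (1.2); Z. Bradshaw, T.-P. Tsai, Comm. PDE 42 (2017), §5 Open Problem 5.1.
-/

noncomputable section

open MeasureTheory Set Function Filter
open scoped ENNReal NNReal
open Literature.Analysis.FluidPDE Literature.Analysis.FunctionSpaces

namespace Summit.NavierStokesRegularity.FluidComputer.DyadicSelfSimilarLadder

/-! ## §1 Dyadic dilation covariance of the Littlewood–Paley blocks -/

section Dilation

variable {E : Type*} [NormedAddCommGroup E] [InnerProductSpace ℝ E] [FiniteDimensional ℝ E]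
  [MeasurableSpace E] [BorelSpace E]
variable {E' : Type*} [NormedAddCommGroup E'] [NormedSpace ℝ E']

/-- The kernel one level up is the `2^d`-normalised dilate: `K_{j+1}(t) = 2^d K_j(2t)`, `d = dim E`. -/
theorem blockKernel_succ (j : ℤ) (t : E) :
    blockKernel E (j + 1) t = (2 : ℝ) ^ Module.finrank ℝ E * blockKernel E j ((2 : ℝ) • t) := by
  rw [blockKernel_eq_scale (j + 1) t, blockKernel_eq_scale j ((2 : ℝ) • t), smul_smul,
    ← zpow_add_one₀ (two_ne_zero : (2 : ℝ) ≠ 0), ← mul_assoc]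
  congr 1
  rw [add_mul, one_mul, zpow_add₀ (two_ne_zero : (2 : ℝ) ≠ 0), zpow_natCast, mul_comm]

/-- **Dyadic dilation covariance of the blocks**: `Δ̇_{j+1}(v(2·)) = (Δ̇_j v)(2·)`. -/
theorem blockFn_succ_comp_two_smul (j : ℤ) (v : E → E') :
    blockFn (j + 1) (fun x => v ((2 : ℝ) • x)) = fun x => blockFn j v ((2 : ℝ) • x) := by
  funext x
  rw [blockFn_apply, blockFn_apply]
  have h : (fun t => blockKernel E (j + 1) t • v ((2 : ℝ) • (x - t))) =
      fun t => ((2 : ℝ) ^ Module.finrank ℝ E) •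
        (fun s => blockKernel E j s • v ((2 : ℝ) • x - s)) ((2 : ℝ) • t) := by
    funext t
    simp only [blockKernel_succ, smul_sub, mul_smul]
  rw [h, integral_smul, Measure.integral_comp_smul volume
    (fun s => blockKernel E j s • v ((2 : ℝ) • x - s)) (2 : ℝ), smul_smul,
    abs_of_pos (inv_pos.2 (pow_pos two_pos _)), mul_inv_cancel₀ (pow_ne_zero _ two_ne_zero),
    one_smul]

/-- The same with an amplitude: `Δ̇_{j+1}(c · v(2·)) = c · (Δ̇_j v)(2·)`. -/
theorem blockFn_succ_smul_comp_two_smul (j : ℤ) (c : ℝ) (v : E → E') :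
    blockFn (j + 1) (fun x => c • v ((2 : ℝ) • x)) = fun x => c • blockFn j v ((2 : ℝ) • x) := by
  have h : (fun x => c • v ((2 : ℝ) • x)) = c • (fun x => v ((2 : ℝ) • x)) := rfl
  rw [h, blockFn_smul, blockFn_succ_comp_two_smul]
  rfl

/-- Over `n` levels: `Δ̇_{j+n}(v(2ⁿ·)) = (Δ̇_j v)(2ⁿ·)`. -/
theorem blockFn_add_comp_pow_smul (j : ℤ) (n : ℕ) (v : E → E') :
    blockFn (j + n) (fun x => v (((2 : ℝ) ^ n) • x)) = fun x => blockFn j v (((2 : ℝ) ^ n) • x) := by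
  induction n generalizing v with
  | zero => simp
  | succ n ih =>
      have hv : (fun x => v (((2 : ℝ) ^ (n + 1)) • x)) =
          fun x => v (((2 : ℝ) ^ n) • ((2 : ℝ) • x)) := by
        funext x
        rw [pow_succ, mul_smul]
      have hj : (j : ℤ) + ((n + 1 : ℕ) : ℤ) = (j + n) + 1 := by push_cast; ring
      rw [hj, hv, blockFn_succ_comp_two_smul (j + n) (fun y => v (((2 : ℝ) ^ n) • y)), ih]
      funext x
      rw [pow_succ, mul_smul]

omit [NormedSpace ℝ E'] in
/-- The `L^∞` norm is dilation invariant: `‖w(2·)‖_∞ = ‖w‖_∞` (`p = ∞` case of the tree's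
`eLpNorm_comp_smul`). -/
theorem eLpNorm_top_comp_two_smul (w : E → E') :
    eLpNorm (fun x => w ((2 : ℝ) • x)) ∞ volume = eLpNorm w ∞ volume := by
  rw [eLpNorm_comp_smul ∞ w (two_ne_zero : (2 : ℝ) ≠ 0)]
  simp

/-- **One-level gain of a dilate**: `‖Δ̇_{j+1}(c · v(2·))‖_∞ = |c| · ‖Δ̇_j v‖_∞`. -/
theorem eLpNorm_top_blockFn_succ_dilate (j : ℤ) (c : ℝ) (v : E → E') :
    eLpNorm (blockFn (j + 1) (fun x => c • v ((2 : ℝ) • x))) ∞ volume =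
      ‖c‖ₑ * eLpNorm (blockFn j v) ∞ volume := by
  rw [blockFn_succ_smul_comp_two_smul]
  have h : (fun x => c • blockFn j v ((2 : ℝ) • x)) = c • (fun x => blockFn j v ((2 : ℝ) • x)) := rfl
  rw [h, eLpNorm_const_smul, eLpNorm_top_comp_two_smul]

end Dilation

/-! ## §2 The ladder of a `2`-discretely-self-similar field -/

section DSS

variable {E : Type*} [NormedAddCommGroup E] [InnerProductSpace ℝ E] [FiniteDimensional ℝ E]
  [MeasurableSpace E] [BorelSpace E]
variable {E' : Type*} [NormedAddCommGroup E'] [NormedSpace ℝ E']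
variable {u : ℝ → E → E'}

omit [FiniteDimensional ℝ E] [MeasurableSpace E] [BorelSpace E] in
/-- The slices of a `2`-DSS field: `u(t) = 2 · u(4t)(2·)`. -/
theorem slice_eq_of_dss (h : IsDiscretelySelfSimilar 2 u) (t : ℝ) :
    u t = fun x => (2 : ℝ) • u (4 * t) ((2 : ℝ) • x) := by
  funext x
  have hx := congrFun (congrFun h t) x
  rw [nsRescale_apply] at hx
  rw [← hx]
  norm_num

/-- **Level `j+1` at time `t` is level `j` at the earlier time `4t`, dilated and doubled.** -/
theorem blockFn_succ_of_dss (h : IsDiscretelySelfSimilar 2 u) (j : ℤ) (t : ℝ) :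
    blockFn (j + 1) (u t) = fun x => (2 : ℝ) • blockFn j (u (4 * t)) ((2 : ℝ) • x) := by
  rw [slice_eq_of_dss h t, blockFn_succ_smul_comp_two_smul]

/-- **The DSS ladder has gain exactly `2` at every level**: `‖Δ̇_{j+1} u(t)‖_∞ = 2 ‖Δ̇_j u(4t)‖_∞`.
In the rung's currency (`RGFixedPoint.LevelMap.levelRatio`) this is `r = g/λ = 1` at every level: the
floor `r ≥ 1` is met with equality by every `2`-DSS field. -/
theorem eLpNorm_top_blockFn_succ_of_dss (h : IsDiscretelySelfSimilar 2 u) (j : ℤ) (t : ℝ) :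
    eLpNorm (blockFn (j + 1) (u t)) ∞ volume = 2 * eLpNorm (blockFn j (u (4 * t))) ∞ volume := by
  rw [slice_eq_of_dss h t, eLpNorm_top_blockFn_succ_dilate]
  congr 1
  rw [Real.enorm_eq_ofReal (by norm_num : (0 : ℝ) ≤ 2)]
  norm_num

/-- Saturation climbs one level per period: level `j+1` of `u(t)` is saturated iff level `j` of
`u(4t)` is. -/
theorem isSaturatedLevel_succ_iff_of_dss (h : IsDiscretelySelfSimilar 2 u) (c₀ ν : ℝ) (j : ℕ)
    (t : ℝ) : IsSaturatedLevel c₀ ν (u t) (j + 1) ↔ IsSaturatedLevel c₀ ν (u (4 * t)) j := by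
  rw [isSaturatedLevel_iff, isSaturatedLevel_iff]
  have hj : ((j + 1 : ℕ) : ℤ) = (j : ℤ) + 1 := by push_cast; ring
  rw [hj, eLpNorm_top_blockFn_succ_of_dss h, pow_succ, ← mul_assoc, mul_comm _ (2 : ℝ≥0∞)]
  exact ENNReal.mul_le_mul_iff_right two_ne_zero ENNReal.ofNat_ne_top

/-- The frontier at most doubles per period: `Λ(u t) ≤ 2 Λ(u(4t))`. -/
theorem dissipationWavenumber_le_two_mul_of_dss (h : IsDiscretelySelfSimilar 2 u) (c₀ ν : ℝ)
    (t : ℝ) :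
    dissipationWavenumber c₀ ν (u t) ≤ 2 * dissipationWavenumber c₀ ν (u (4 * t)) := by
  have h1 : (1 : ℝ≥0∞) ≤ 2 * dissipationWavenumber c₀ ν (u (4 * t)) :=
    le_trans (by norm_num) (mul_le_mul' le_rfl (one_le_dissipationWavenumber c₀ ν (u (4 * t))))
  refine dissipationWavenumber_le h1 fun j hj => ?_
  rcases j with _ | i
  · simpa using h1
  · rw [isSaturatedLevel_succ_iff_of_dss h] at hj
    rw [pow_succ, mul_comm]
    exact mul_le_mul' le_rfl (two_pow_le_dissipationWavenumber hj)

/-- Once some level of `u(4t)` is saturated the frontier at least doubles: `2 Λ(u(4t)) ≤ Λ(u t)`. -/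
theorem two_mul_dissipationWavenumber_le_of_dss (h : IsDiscretelySelfSimilar 2 u) {c₀ ν : ℝ} {t : ℝ}
    (hsat : ∃ i : ℕ, IsSaturatedLevel c₀ ν (u (4 * t)) i) :
    2 * dissipationWavenumber c₀ ν (u (4 * t)) ≤ dissipationWavenumber c₀ ν (u t) := by
  obtain ⟨i₀, hi₀⟩ := hsat
  -- `2 ≤ Λ(u t)`: level `i₀ + 1 ≥ 1` of `u t` is saturated
  have hstep : ∀ i : ℕ, IsSaturatedLevel c₀ ν (u (4 * t)) i →
      2 * (2 : ℝ≥0∞) ^ i ≤ dissipationWavenumber c₀ ν (u t) := fun i hi => by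
    rw [← pow_succ']
    exact two_pow_le_dissipationWavenumber ((isSaturatedLevel_succ_iff_of_dss h c₀ ν i t).2 hi)
  have hdef : dissipationWavenumber c₀ ν (u (4 * t)) =
      1 ⊔ ⨆ (j : ℕ) (_ : IsSaturatedLevel c₀ ν (u (4 * t)) j), (2 : ℝ≥0∞) ^ j := rfl
  -- with a saturated level the `1 ⊔` is absorbed
  have hS1 : (1 : ℝ≥0∞) ≤ ⨆ (j : ℕ) (_ : IsSaturatedLevel c₀ ν (u (4 * t)) j), (2 : ℝ≥0∞) ^ j :=
    le_trans (one_le_pow₀ one_le_two)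
      (le_iSup₂_of_le (f := fun (j : ℕ) (_ : IsSaturatedLevel c₀ ν (u (4 * t)) j) => (2 : ℝ≥0∞) ^ j)
        i₀ hi₀ le_rfl)
  rw [hdef, sup_eq_right.2 hS1, ENNReal.mul_iSup]
  refine iSup_le fun i => ?_
  rw [ENNReal.mul_iSup]
  exact iSup_le fun hi => hstep i hi

/-- **The frontier doubles every period**: if some level of `u(4t)` is saturated then
`Λ(u t) = 2 Λ(u(4t))` — along a `2`-DSS field the Cheskidov–Shvydkoy dissipation wavenumber is itself
discretely self-similar, `Λ(t) = 2 Λ(4t)`, i.e. `Λ(t) ∝ (−t)^{-1/2}` up to a log-periodic factor. -/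
theorem dissipationWavenumber_eq_two_mul_of_dss (h : IsDiscretelySelfSimilar 2 u) {c₀ ν : ℝ} {t : ℝ}
    (hsat : ∃ i : ℕ, IsSaturatedLevel c₀ ν (u (4 * t)) i) :
    dissipationWavenumber c₀ ν (u t) = 2 * dissipationWavenumber c₀ ν (u (4 * t)) :=
  le_antisymm (dissipationWavenumber_le_two_mul_of_dss h c₀ ν t)
    (two_mul_dissipationWavenumber_le_of_dss h hsat)

/-- The frontier never recedes along the period map: `Λ(u(4t)) ≤ Λ(u t)`. -/
theorem dissipationWavenumber_mono_of_dss (h : IsDiscretelySelfSimilar 2 u) (c₀ ν : ℝ) (t : ℝ) :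
    dissipationWavenumber c₀ ν (u (4 * t)) ≤ dissipationWavenumber c₀ ν (u t) := by
  by_cases hsat : ∃ i : ℕ, IsSaturatedLevel c₀ ν (u (4 * t)) i
  · exact le_trans (le_mul_of_one_le_left (by simp) (by norm_num))
      (two_mul_dissipationWavenumber_le_of_dss h hsat)
  · push Not at hsat
    have : dissipationWavenumber c₀ ν (u (4 * t)) ≤ 1 :=
      dissipationWavenumber_le le_rfl fun j hj => absurd hj (hsat j)
    exact this.trans (one_le_dissipationWavenumber c₀ ν (u t))

/-- Finite frontier is a period-invariant property: `Λ(u t) < ∞ ↔ Λ(u(4t)) < ∞`. -/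
theorem dissipationWavenumber_lt_top_iff_of_dss (h : IsDiscretelySelfSimilar 2 u) (c₀ ν : ℝ)
    (t : ℝ) :
    dissipationWavenumber c₀ ν (u t) < ∞ ↔ dissipationWavenumber c₀ ν (u (4 * t)) < ∞ := by
  constructor
  · exact fun hlt => lt_of_le_of_lt (dissipationWavenumber_mono_of_dss h c₀ ν t) hlt
  · intro hlt
    exact lt_of_le_of_lt (dissipationWavenumber_le_two_mul_of_dss h c₀ ν t)
      (ENNReal.mul_lt_top (by simp) hlt)

end DSS

end Summit.NavierStokesRegularity.FluidComputer.DyadicSelfSimilarLadder
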